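import Summits.QuantumFields.YangMills.Theorems.ColdStartUniversalityLatticeLangevinDeltaMethodGaussian
import Summits.QuantumFields.YangMills.Theorems.ColdStartUniversalityLatticeLangevinBatchCovariance
import Summits.QuantumFields.YangMills.Theorems.ColdStartUniversalityLatticeLangevinAlmostSureErgodic
import Summits.QuantumFields.YangMills.Theorems.ColdStartUniversalityLatticeLangevinSplice
import Mathlib.Analysis.Calculus.FDeriv.Measurable
import HarnessLib

/-!
# Route `ColdStartUniversality` (fixed-cut-off SZZ dynamics, sampler package): ★★★ THE STUDENTISED DELTA METHOD — asymptotically exact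
# confidence intervals for smooth functions of several equilibrium expectations, computed from ONE cold-start run

Helper file (seat `ym-line-csu-p1`, g35; `--supports stmt-QuantumFields-24809`).  For finitely many continuous observables `|Gᵢ| ≤ 1` with mean
vector `m = (μ_(β')Gᵢ)ᵢ` and Green–Kubo covariance matrix `S`, every measurable `h : ℝ^ι → ℝ` that is `C¹` at `m` with `∇h(m)ᵀS∇h(m) > 0`, EVERY
strong solution `U` of the SU(2) SZZ dynamics from EVERY deterministic start, every block scheme `b_n → ∞, J_n → ∞, b_n/J_n → 0` (`T_n = J_nb_n`):

  `√T_n (h(X̄_(T_n)) − h(m)) / σ̂_n  ⇒  N(0, 1)`   (★★★ `studentised_deltaMethod_clt`),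

where EVERYTHING in the statistic is computed from the data: `X̄_T` the vector of time averages, `σ̂_n² = âᵀ M̂ â` with the PLUG-IN GRADIENT
`âₖ = ∂ₖh(X̄_(T_n))` (`fderiv`) and the POLARISED BATCH-COVARIANCE MATRIX `M̂ₖₗ` (file `…BatchCovariance`).  Hence `h(X̄_T) ± z·σ̂/√T` is an
asymptotically exact confidence interval for `h(m)` (e.g. ratios / logarithms of ratios of Wilson-loop expectations).  Proof: the delta method with
explicit Gaussian limit (file 104), the a.s. ergodic theorem (`X̄_T → m`), continuity of `∇h` at `m`, consistency of `M̂` (105b), the algebra of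
convergence in probability (105a), Slutsky with a truncated quotient and removal of the truncation (as in file 95b); first for progressively
measurable solutions (`…_of_prog`), then for every solution via the regular flow and pathwise uniqueness.  THEOREMS ONLY, no definition, no sorry;
[folklore].
HONEST FRAMING: fixed cut-off; `S`, `m` depend on `L, β'`; `UniformColdStartMixing` (24809) is NOT restated; no crux, rung or summit statement is
proved; the Yang–Mills mass gap is NOT proved.
-/

set_option autoImplicit false

noncomputable section

namespace Summit.QuantumFields.YangMills.Theorems.ColdStartUniversality

open MeasureTheory ProbabilityTheory Filter Topology Set Matrix
open scoped NNReal ENNReal BigOperators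
open Literature Literature.Probability.Process Literature.MathematicalPhysics.QuantumFieldTheory
open Literature.MathematicalPhysics.QuantumLattice (fundamentalRep fundamentalLatticeRep continuous_fundamentalRep)

variable {L : ℕ} [NeZero L]

/-- The studentised delta method for PROGRESSIVELY MEASURABLE strong solutions (auxiliary; see `studentised_deltaMethod_clt`). [folklore] -/
theorem studentised_deltaMethod_clt_of_prog (L : ℕ) [NeZero L] (β' : ℝ)
    (κ : ℝ≥0 → Kernel (GaugeConfig 3 L (Matrix.specialUnitaryGroup (Fin 2) ℂ))
      (GaugeConfig 3 L (Matrix.specialUnitaryGroup (Fin 2) ℂ))) [∀ t, IsMarkovKernel (κ t)]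
    (hreal : ∀ (t : ℝ≥0) (x : GaugeConfig 3 L (Matrix.specialUnitaryGroup (Fin 2) ℂ))
        (Ω : Type) [MeasurableSpace Ω] (P : Measure Ω) [IsProbabilityMeasure P]
        (W : ℝ≥0 → Ω → (Edge 3 L × NoiseIdx 2 → ℝ)) (hW : IsFlatBrownian W P)
        (U : ℝ≥0 → Ω → GaugeConfig 3 L (Matrix.specialUnitaryGroup (Fin 2) ℂ)),
        (∀ ω, U 0 ω = x) →
        (latticeLangevinDynamics (fundamentalLatticeRep 2) β').IsSolution (fundamentalRep (Fin 2))
          hW.natFiltration P W U →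
        κ t x = P.map (U t))
    (x₀ : GaugeConfig 3 L (Matrix.specialUnitaryGroup (Fin 2) ℂ))
    {Ω : Type} [MeasurableSpace Ω] {P : Measure Ω} [IsProbabilityMeasure P]
    {W : ℝ≥0 → Ω → (Edge 3 L × NoiseIdx 2 → ℝ)} (hW : IsFlatBrownian W P)
    {U : ℝ≥0 → Ω → GaugeConfig 3 L (Matrix.specialUnitaryGroup (Fin 2) ℂ)} (hU0 : ∀ ω, U 0 ω = x₀)
    (hU : (latticeLangevinDynamics (fundamentalLatticeRep 2) β').IsSolution (fundamentalRep (Fin 2)) hW.natFiltration P W U)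
    (hprog : ∀ i : ℝ≥0, Measurable[@Prod.instMeasurableSpace (Set.Iic i) Ω inferInstance (hW.natFiltration i)]
      (fun q : Set.Iic i × Ω => U q.1 q.2))
    {ι : Type} [Fintype ι] [DecidableEq ι]
    {G : ι → GaugeConfig 3 L (Matrix.specialUnitaryGroup (Fin 2) ℂ) → ℝ} (hGc : ∀ i, Continuous (G i)) (hG1 : ∀ i z, |G i z| ≤ 1)
    {S : Matrix ι ι ℝ}
    (hS : S = fun i j => ∫ t in Ioi (0 : ℝ),
      (∫ y, ((G i y - ∫ z, G i z ∂(wilsonMeasure (d := 3) (L := L) (fundamentalRep (Fin 2)) β')) *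
          (∫ z, (G j z - ∫ z', G j z' ∂(wilsonMeasure (d := 3) (L := L) (fundamentalRep (Fin 2)) β')) ∂(κ t.toNNReal y)) +
        (G j y - ∫ z, G j z ∂(wilsonMeasure (d := 3) (L := L) (fundamentalRep (Fin 2)) β')) *
          (∫ z, (G i z - ∫ z', G i z' ∂(wilsonMeasure (d := 3) (L := L) (fundamentalRep (Fin 2)) β')) ∂(κ t.toNNReal y)))
        ∂(wilsonMeasure (d := 3) (L := L) (fundamentalRep (Fin 2)) β')))
    {h : EuclideanSpace ℝ ι → ℝ} (hhm : Measurable h)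
    (hC1 : ContDiffAt ℝ 1 h (WithLp.toLp 2 fun i => ∫ z, G i z ∂(wilsonMeasure (d := 3) (L := L) (fundamentalRep (Fin 2)) β')))
    (hv : 0 < (fun i => fderiv ℝ h (WithLp.toLp 2 fun i => ∫ z, G i z ∂(wilsonMeasure (d := 3) (L := L) (fundamentalRep (Fin 2)) β'))
        (EuclideanSpace.single i (1 : ℝ))) ⬝ᵥ
      S *ᵥ (fun i => fderiv ℝ h (WithLp.toLp 2 fun i => ∫ z, G i z ∂(wilsonMeasure (d := 3) (L := L) (fundamentalRep (Fin 2)) β'))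
        (EuclideanSpace.single i (1 : ℝ))))
    (b : ℕ → ℝ) (J : ℕ → ℕ) (hb : ∀ n, 0 < b n) (hJ : ∀ n, 1 ≤ J n)
    (hb_top : Tendsto b atTop atTop) (hJ_top : Tendsto (fun n => (J n : ℝ)) atTop atTop)
    (hbJ : Tendsto (fun n => b n / J n) atTop (𝓝 0))
    (Ω' : Type) [MeasurableSpace Ω'] (P' : Measure Ω') [IsProbabilityMeasure P'] (Z : Ω' → ℝ) (hZ : HasLaw Z (gaussianReal 0 1) P') :
    TendstoInDistribution (fun (n : ℕ) ω =>
        Real.sqrt ((J n : ℝ) * b n) *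
          (h (WithLp.toLp 2 fun i => ((J n : ℝ) * b n)⁻¹ * ∫ r in Ioc (0 : ℝ) ((J n : ℝ) * b n), G i (U r.toNNReal ω)) -
          h (WithLp.toLp 2 fun i => ∫ z, G i z ∂(wilsonMeasure (d := 3) (L := L) (fundamentalRep (Fin 2)) β'))) /
        Real.sqrt (∑ k, fderiv ℝ h
            (WithLp.toLp 2 fun i => ((J n : ℝ) * b n)⁻¹ * ∫ r in Ioc (0 : ℝ) ((J n : ℝ) * b n), G i (U r.toNNReal ω))
            (EuclideanSpace.single k (1 : ℝ)) *
          ∑ l, (b n / J n * ∑ j ∈ Finset.range (J n),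
              ((∫ r in Ioc ((j : ℝ) * b n) (((j : ℝ) + 1) * b n),
                  (∑ i, ((if i = k then 1 / 2 else 0) + (if i = l then 1 / 2 else 0)) * G i (U r.toNNReal ω))) / b n -
                ((J n : ℝ) * b n)⁻¹ * ∑ j' ∈ Finset.range (J n), ∫ r in Ioc ((j' : ℝ) * b n) (((j' : ℝ) + 1) * b n),
                  (∑ i, ((if i = k then 1 / 2 else 0) + (if i = l then 1 / 2 else 0)) * G i (U r.toNNReal ω))) ^ 2 -
            b n / J n * ∑ j ∈ Finset.range (J n),
              ((∫ r in Ioc ((j : ℝ) * b n) (((j : ℝ) + 1) * b n),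
                  (∑ i, ((if i = k then 1 / 2 else 0) - (if i = l then 1 / 2 else 0)) * G i (U r.toNNReal ω))) / b n -
                ((J n : ℝ) * b n)⁻¹ * ∑ j' ∈ Finset.range (J n), ∫ r in Ioc ((j' : ℝ) * b n) (((j' : ℝ) + 1) * b n),
                  (∑ i, ((if i = k then 1 / 2 else 0) - (if i = l then 1 / 2 else 0)) * G i (U r.toNNReal ω))) ^ 2) *
            fderiv ℝ h
            (WithLp.toLp 2 fun i => ((J n : ℝ) * b n)⁻¹ * ∫ r in Ioc (0 : ℝ) ((J n : ℝ) * b n), G i (U r.toNNReal ω))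
            (EuclideanSpace.single l (1 : ℝ))))
      atTop Z (fun _ => P) P' := by
  classical
  haveI := secondCountableTopology_su2
  haveI := borelSpace_config L
  set μ : Measure (GaugeConfig 3 L (Matrix.specialUnitaryGroup (Fin 2) ℂ)) :=
    wilsonMeasure (d := 3) (L := L) (fundamentalRep (Fin 2)) β' with hμ
  haveI : IsProbabilityMeasure μ :=
    isProbabilityMeasure_wilsonMeasure (d := 3) (L := L) (fundamentalRep (Fin 2)) (continuous_fundamentalRep (Fin 2)) β'
  set m : ι → ℝ := fun i => ∫ z, G i z ∂μ with hm
  set mv : EuclideanSpace ℝ ι := WithLp.toLp 2 m with hmv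
  set h' : EuclideanSpace ℝ ι →L[ℝ] ℝ := fderiv ℝ h mv with hh'
  set a : ι → ℝ := fun i => h' (EuclideanSpace.single i (1 : ℝ)) with ha
  set v : ℝ := a ⬝ᵥ S *ᵥ a with hvdef
  have hv0 : 0 ≤ v := hv.le
  have hsv : 0 < Real.sqrt v := Real.sqrt_pos.2 hv
  set T : ℕ → ℝ := fun n => (J n : ℝ) * b n with hT
  have hTpos : ∀ n, 0 < T n := fun n => mul_pos (by have := hJ n; positivity) (hb n)
  have hTtop : Tendsto T atTop atTop := by
    refine tendsto_atTop_mono (fun n => ?_) hb_top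
    have h1 : (1 : ℝ) ≤ J n := by exact_mod_cast hJ n
    simp only [hT]; nlinarith [hb n]
  -- the data-driven objects
  set Xb : ℕ → Ω → EuclideanSpace ℝ ι := fun n ω =>
    WithLp.toLp 2 fun i => (T n)⁻¹ * ∫ r in Ioc (0 : ℝ) (T n), G i (U r.toNNReal ω) with hXb
  set Num : ℕ → Ω → ℝ := fun n ω => Real.sqrt (T n) * (h (Xb n ω) - h mv) with hNum
  set ah : ℕ → Ω → ι → ℝ := fun n ω i => fderiv ℝ h (Xb n ω) (EuclideanSpace.single i (1 : ℝ)) with hah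
  set Mp : ι → ι → ℕ → Ω → ℝ := fun k l n ω => b n / J n * ∑ j ∈ Finset.range (J n),
              ((∫ r in Ioc ((j : ℝ) * b n) (((j : ℝ) + 1) * b n),
                  (∑ i, ((if i = k then 1 / 2 else 0) + (if i = l then 1 / 2 else 0)) * G i (U r.toNNReal ω))) / b n -
                ((J n : ℝ) * b n)⁻¹ * ∑ j' ∈ Finset.range (J n), ∫ r in Ioc ((j' : ℝ) * b n) (((j' : ℝ) + 1) * b n),
                  (∑ i, ((if i = k then 1 / 2 else 0) + (if i = l then 1 / 2 else 0)) * G i (U r.toNNReal ω))) ^ 2 with hMp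
  set Mm : ι → ι → ℕ → Ω → ℝ := fun k l n ω => b n / J n * ∑ j ∈ Finset.range (J n),
              ((∫ r in Ioc ((j : ℝ) * b n) (((j : ℝ) + 1) * b n),
                  (∑ i, ((if i = k then 1 / 2 else 0) - (if i = l then 1 / 2 else 0)) * G i (U r.toNNReal ω))) / b n -
                ((J n : ℝ) * b n)⁻¹ * ∑ j' ∈ Finset.range (J n), ∫ r in Ioc ((j' : ℝ) * b n) (((j' : ℝ) + 1) * b n),
                  (∑ i, ((if i = k then 1 / 2 else 0) - (if i = l then 1 / 2 else 0)) * G i (U r.toNNReal ω))) ^ 2 with hMm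
  set est : ℕ → Ω → ℝ := fun n ω => ∑ k, ah n ω k * ∑ l, (Mp k l n ω - Mm k l n ω) * ah n ω l with hest
  set Sn : ℕ → Ω → ℝ := fun n ω => Num n ω / Real.sqrt (est n ω) with hSn
  /- ### 1. The delta method with limit `√v · Z` -/
  have hZv : HasLaw (fun ω' => Real.sqrt v * Z ω') (gaussianReal 0 v.toNNReal) P' := by
    have h1 := gaussianReal_const_mul hZ (Real.sqrt v)
    have h0 : Real.sqrt v * 0 = 0 := mul_zero _
    have h2 : (NNReal.mk (Real.sqrt v ^ 2) (sq_nonneg _)) * 1 = v.toNNReal := by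
      ext; simp [Real.sq_sqrt hv0, Real.coe_toNNReal _ hv0]
    rw [h0, h2] at h1
    exact h1
  have hfd : HasFDerivAt h h' mv := (hC1.differentiableAt one_ne_zero).hasFDerivAt
  have hD : TendstoInDistribution Num atTop (fun ω' => Real.sqrt v * Z ω') (fun _ => P) P' :=
    deltaMethod_timeAverage_clt_gaussian L β' κ hreal x₀ hW hU0 hU hGc hG1 hS hhm hfd Ω' P' _ hZv T hTtop hTpos
  /- ### 2. `X̄ → m` in probability (a.s. ergodic theorem, coordinatewise) -/
  have hpathm : Measurable fun p : Ω × ℝ => U p.2.toNNReal p.1 :=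
    measurable_uncurry_of_prog (Z := U) (fun n : ℕ => hW.natFiltration n) (fun n => hW.natFiltration.le n) (fun n => hprog n)
  have hIm : ∀ i (lo hi : ℝ), Measurable fun ω => ∫ r in Ioc lo hi, G i (U r.toNNReal ω) := fun i lo hi => by
    have h1 : Measurable (Function.uncurry fun (ω : Ω) (r : ℝ) => G i (U r.toNNReal ω)) := (hGc i).measurable.comp hpathm
    exact (h1.stronglyMeasurable.integral_prod_right' (ν := volume.restrict (Ioc lo hi))).measurable
  have hXbm : ∀ n, Measurable (Xb n) := fun n =>
    (WithLp.measurable_toLp 2 _).comp (measurable_pi_lambda _ fun i => (hIm i _ _).const_mul _)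
  have hXlim : TendstoInMeasure P Xb atTop fun _ => mv := by
    have hco : ∀ i, ∀ᵐ ω ∂P, Tendsto (fun n => (T n)⁻¹ * ∫ r in Ioc (0 : ℝ) (T n), G i (U r.toNNReal ω)) atTop (𝓝 (m i)) :=
      fun i => by
      filter_upwards [LiebRobinson.ae_tendsto_timeAverage_wilson L β' x₀ hW hU0 hU (hGc i).measurable (hG1 i)] with ω hω
      exact hω.comp hTtop
    refine tendstoInMeasure_of_tendsto_ae (fun n => (hXbm n).aestronglyMeasurable) ?_
    filter_upwards [ae_all_iff.2 hco] with ω hω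
    have hpi : Tendsto (fun n => fun i => (T n)⁻¹ * ∫ r in Ioc (0 : ℝ) (T n), G i (U r.toNNReal ω)) atTop (𝓝 m) :=
      tendsto_pi_nhds.2 hω
    exact ((PiLp.continuous_toLp 2 (fun _ : ι => ℝ)).tendsto m).comp hpi
  /- ### 3. The plug-in gradient and the batch covariance are consistent; `σ̂² → v` -/
  have hahlim : ∀ k, TendstoInMeasure P (fun n ω => ah n ω k) atTop fun _ => a k := fun k => by
    have hcont : ContinuousAt (fun y : EuclideanSpace ℝ ι => fderiv ℝ h y (EuclideanSpace.single k (1 : ℝ))) mv :=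
      (hC1.continuousAt_fderiv one_ne_zero).clm_apply continuousAt_const
    have h1 := tendstoInMeasure_continuousAt_comp_of_const hcont hXlim
    exact h1
  have hahm : ∀ n k, AEMeasurable (fun ω => ah n ω k) P := fun n k =>
    ((measurable_fderiv_apply_const ℝ h (EuclideanSpace.single k (1 : ℝ))).comp (hXbm n)).aemeasurable
  have hM : ∀ k l, (∀ n, AEMeasurable (fun ω => Mp k l n ω - Mm k l n ω) P) ∧
      TendstoInMeasure P (fun n ω => Mp k l n ω - Mm k l n ω) atTop fun _ => S k l := fun k l =>
    tendstoInMeasure_batchCovariance L β' κ hreal x₀ hW hU0 hU hGc hG1 hS k l b J hb hJ hb_top hJ_top hbJ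
  have hestlim : TendstoInMeasure P est atTop fun _ => v := by
    have h1 : ∀ k, TendstoInMeasure P (fun n ω => ∑ l, (Mp k l n ω - Mm k l n ω) * ah n ω l) atTop fun _ => ∑ l, S k l * a l :=
      fun k => tendstoInMeasure_sum_of_const Finset.univ fun l _ => tendstoInMeasure_mul_of_const (hM k l).2 (hahlim l)
    have h2 := tendstoInMeasure_sum_of_const (P := P) (l := atTop) Finset.univ fun k _ =>
      tendstoInMeasure_mul_of_const (hahlim k) (h1 k)
    exact h2
  have hestm : ∀ n, AEMeasurable (est n) P := fun n =>
    Finset.aemeasurable_fun_sum _ fun k _ => (hahm n k).mul (Finset.aemeasurable_fun_sum _ fun l _ => ((hM k l).1 n).mul (hahm n l))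
  /- ### 4. Slutsky with the truncated quotient -/
  set g : ℝ × ℝ → ℝ := fun p => p.1 / max (Real.sqrt p.2) (Real.sqrt v / 2) with hg
  have hgc : Continuous g :=
    continuous_fst.div (continuous_snd.sqrt.max continuous_const) fun p => (lt_max_of_lt_right (by positivity)).ne'
  have hslutsky := hD.continuous_comp_prodMk_of_tendstoInMeasure_const hgc hestlim hestm
  have hlim : (fun ω' => g (Real.sqrt v * Z ω', v)) = Z := funext fun ω' => by
    simp only [hg]
    rw [max_eq_left (by linarith)]
    field_simp
  rw [hlim] at hslutsky
  /- ### 5. Removing the truncation -/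
  have hsub : TendstoInMeasure P (Sn - fun n ω => g (Num n ω, est n ω)) atTop 0 := by
    rw [tendstoInMeasure_iff_norm]
    intro ε hε
    have h34 : (0 : ℝ) < 3 * v / 4 := by positivity
    have hP := (tendstoInMeasure_iff_norm.1 hestlim) (3 * v / 4) h34
    refine tendsto_of_tendsto_of_tendsto_of_le_of_le tendsto_const_nhds hP (fun n => bot_le) fun n => ?_
    refine measure_mono fun ω hω => ?_
    simp only [Set.mem_setOf_eq, Pi.sub_apply, Pi.zero_apply, sub_zero] at hω ⊢
    by_contra hlt
    push Not at hlt
    have hge : v / 4 ≤ est n ω := by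
      rw [Real.norm_eq_abs] at hlt
      have := abs_lt.1 hlt
      linarith
    have hsq : Real.sqrt v / 2 ≤ Real.sqrt (est n ω) := by
      rw [show Real.sqrt v / 2 = Real.sqrt (v / 4) by
        rw [show v / 4 = v / 2 ^ 2 by norm_num, Real.sqrt_div' _ (by norm_num : (0:ℝ) ≤ 2 ^ 2), Real.sqrt_sq (by norm_num : (0 : ℝ) ≤ 2)]]
      exact Real.sqrt_le_sqrt hge
    have heq : Sn n ω = g (Num n ω, est n ω) := by
      simp only [hSn, hg]; rw [max_eq_left hsq]
    rw [heq, sub_self, norm_zero] at hω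
    linarith
  have hSm : ∀ n, AEMeasurable (Sn n) P := fun n => (hD.forall_aemeasurable n).div (hestm n).sqrt
  exact tendstoInDistribution_of_tendstoInMeasure_sub Sn Z hslutsky hsub hSm

/-- ★★★ **Studentised delta method for the cold-start SZZ sampler** (see the module docstring): for every strong solution from a deterministic
start, `√T_n (h(X̄_(T_n)) − h(m)) / σ̂_n → N(0,1)` in distribution, `σ̂_n² = âᵀM̂â` with the plug-in gradient and the polarised batch-covariance
matrix, both computed from the data (fixed cut-off; `∇h(m)ᵀS∇h(m) > 0`). [folklore] -/
theorem studentised_deltaMethod_clt (L : ℕ) [NeZero L] (β' : ℝ)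
    (κ : ℝ≥0 → Kernel (GaugeConfig 3 L (Matrix.specialUnitaryGroup (Fin 2) ℂ))
      (GaugeConfig 3 L (Matrix.specialUnitaryGroup (Fin 2) ℂ))) [∀ t, IsMarkovKernel (κ t)]
    (hreal : ∀ (t : ℝ≥0) (x : GaugeConfig 3 L (Matrix.specialUnitaryGroup (Fin 2) ℂ))
        (Ω : Type) [MeasurableSpace Ω] (P : Measure Ω) [IsProbabilityMeasure P]
        (W : ℝ≥0 → Ω → (Edge 3 L × NoiseIdx 2 → ℝ)) (hW : IsFlatBrownian W P)
        (U : ℝ≥0 → Ω → GaugeConfig 3 L (Matrix.specialUnitaryGroup (Fin 2) ℂ)),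
        (∀ ω, U 0 ω = x) →
        (latticeLangevinDynamics (fundamentalLatticeRep 2) β').IsSolution (fundamentalRep (Fin 2))
          hW.natFiltration P W U →
        κ t x = P.map (U t))
    (x₀ : GaugeConfig 3 L (Matrix.specialUnitaryGroup (Fin 2) ℂ))
    {Ω : Type} [MeasurableSpace Ω] {P : Measure Ω} [IsProbabilityMeasure P]
    {W : ℝ≥0 → Ω → (Edge 3 L × NoiseIdx 2 → ℝ)} (hW : IsFlatBrownian W P)
    {U : ℝ≥0 → Ω → GaugeConfig 3 L (Matrix.specialUnitaryGroup (Fin 2) ℂ)} (hU0 : ∀ ω, U 0 ω = x₀)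
    (hU : (latticeLangevinDynamics (fundamentalLatticeRep 2) β').IsSolution (fundamentalRep (Fin 2)) hW.natFiltration P W U)
    {ι : Type} [Fintype ι] [DecidableEq ι]
    {G : ι → GaugeConfig 3 L (Matrix.specialUnitaryGroup (Fin 2) ℂ) → ℝ} (hGc : ∀ i, Continuous (G i)) (hG1 : ∀ i z, |G i z| ≤ 1)
    {S : Matrix ι ι ℝ}
    (hS : S = fun i j => ∫ t in Ioi (0 : ℝ),
      (∫ y, ((G i y - ∫ z, G i z ∂(wilsonMeasure (d := 3) (L := L) (fundamentalRep (Fin 2)) β')) *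
          (∫ z, (G j z - ∫ z', G j z' ∂(wilsonMeasure (d := 3) (L := L) (fundamentalRep (Fin 2)) β')) ∂(κ t.toNNReal y)) +
        (G j y - ∫ z, G j z ∂(wilsonMeasure (d := 3) (L := L) (fundamentalRep (Fin 2)) β')) *
          (∫ z, (G i z - ∫ z', G i z' ∂(wilsonMeasure (d := 3) (L := L) (fundamentalRep (Fin 2)) β')) ∂(κ t.toNNReal y)))
        ∂(wilsonMeasure (d := 3) (L := L) (fundamentalRep (Fin 2)) β')))
    {h : EuclideanSpace ℝ ι → ℝ} (hhm : Measurable h)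
    (hC1 : ContDiffAt ℝ 1 h (WithLp.toLp 2 fun i => ∫ z, G i z ∂(wilsonMeasure (d := 3) (L := L) (fundamentalRep (Fin 2)) β')))
    (hv : 0 < (fun i => fderiv ℝ h (WithLp.toLp 2 fun i => ∫ z, G i z ∂(wilsonMeasure (d := 3) (L := L) (fundamentalRep (Fin 2)) β'))
        (EuclideanSpace.single i (1 : ℝ))) ⬝ᵥ
      S *ᵥ (fun i => fderiv ℝ h (WithLp.toLp 2 fun i => ∫ z, G i z ∂(wilsonMeasure (d := 3) (L := L) (fundamentalRep (Fin 2)) β'))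
        (EuclideanSpace.single i (1 : ℝ))))
    (b : ℕ → ℝ) (J : ℕ → ℕ) (hb : ∀ n, 0 < b n) (hJ : ∀ n, 1 ≤ J n)
    (hb_top : Tendsto b atTop atTop) (hJ_top : Tendsto (fun n => (J n : ℝ)) atTop atTop)
    (hbJ : Tendsto (fun n => b n / J n) atTop (𝓝 0))
    (Ω' : Type) [MeasurableSpace Ω'] (P' : Measure Ω') [IsProbabilityMeasure P'] (Z : Ω' → ℝ) (hZ : HasLaw Z (gaussianReal 0 1) P') :
    TendstoInDistribution (fun (n : ℕ) ω =>
        Real.sqrt ((J n : ℝ) * b n) *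
          (h (WithLp.toLp 2 fun i => ((J n : ℝ) * b n)⁻¹ * ∫ r in Ioc (0 : ℝ) ((J n : ℝ) * b n), G i (U r.toNNReal ω)) -
          h (WithLp.toLp 2 fun i => ∫ z, G i z ∂(wilsonMeasure (d := 3) (L := L) (fundamentalRep (Fin 2)) β'))) /
        Real.sqrt (∑ k, fderiv ℝ h
            (WithLp.toLp 2 fun i => ((J n : ℝ) * b n)⁻¹ * ∫ r in Ioc (0 : ℝ) ((J n : ℝ) * b n), G i (U r.toNNReal ω))
            (EuclideanSpace.single k (1 : ℝ)) *
          ∑ l, (b n / J n * ∑ j ∈ Finset.range (J n),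
              ((∫ r in Ioc ((j : ℝ) * b n) (((j : ℝ) + 1) * b n),
                  (∑ i, ((if i = k then 1 / 2 else 0) + (if i = l then 1 / 2 else 0)) * G i (U r.toNNReal ω))) / b n -
                ((J n : ℝ) * b n)⁻¹ * ∑ j' ∈ Finset.range (J n), ∫ r in Ioc ((j' : ℝ) * b n) (((j' : ℝ) + 1) * b n),
                  (∑ i, ((if i = k then 1 / 2 else 0) + (if i = l then 1 / 2 else 0)) * G i (U r.toNNReal ω))) ^ 2 -
            b n / J n * ∑ j ∈ Finset.range (J n),
              ((∫ r in Ioc ((j : ℝ) * b n) (((j : ℝ) + 1) * b n),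
                  (∑ i, ((if i = k then 1 / 2 else 0) - (if i = l then 1 / 2 else 0)) * G i (U r.toNNReal ω))) / b n -
                ((J n : ℝ) * b n)⁻¹ * ∑ j' ∈ Finset.range (J n), ∫ r in Ioc ((j' : ℝ) * b n) (((j' : ℝ) + 1) * b n),
                  (∑ i, ((if i = k then 1 / 2 else 0) - (if i = l then 1 / 2 else 0)) * G i (U r.toNNReal ω))) ^ 2) *
            fderiv ℝ h
            (WithLp.toLp 2 fun i => ((J n : ℝ) * b n)⁻¹ * ∫ r in Ioc (0 : ℝ) ((J n : ℝ) * b n), G i (U r.toNNReal ω))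
            (EuclideanSpace.single l (1 : ℝ))))
      atTop Z (fun _ => P) P' := by
  obtain ⟨V, -, hV, hVprog, -, -, -⟩ := exists_regularFlow L β' hW
  have hprog : ∀ i : ℝ≥0, Measurable[@Prod.instMeasurableSpace (Set.Iic i) Ω inferInstance (hW.natFiltration i)]
      (fun q : Set.Iic i × Ω => V x₀ q.1 q.2) := fun i =>
    (hVprog i).comp (measurable_fst.prodMk (measurable_const.prodMk measurable_snd))
  have hae : ∀ᵐ ω ∂P, ∀ t, U t ω = V x₀ t ω := latticeLangevin_pathwise_unique hW β' x₀ hU0 (hV x₀).1 hU (hV x₀).2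
  have hA := studentised_deltaMethod_clt_of_prog L β' κ hreal x₀ hW (hV x₀).1 (hV x₀).2 hprog hGc hG1 hS hhm hC1 hv b J hb hJ hb_top
    hJ_top hbJ Ω' P' Z hZ
  refine hA.congr (fun n => ?_) (ae_eq_refl _)
  filter_upwards [hae] with ω hω
  simp only [hω]

end Summit.QuantumFields.YangMills.Theorems.ColdStartUniversality

end
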